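import Summits.QuantumFields.YangMills.Theorems.AlphaInputsT3ACv3ModelBox
import HarnessLib

/-!
# `AlphaInputsT3ACv3BallGraft` — START v3.1 for the (FL) `hLift` binder, row (S5), part 3: **BALL FIELDS GRAFTED THROUGH THE CHART** — `ballField v R M W` := the model field `M` on the
# bonds with both endpoints in the cube of half-side `R` around the site `v` (read through `boxSite v`), `W` elsewhere; if `M` AGREES with `pullB v W` on the TANGENTIAL BOUNDARY
# bonds (`BdryBond R`) and has `b_B`-flat plaquettes on `PlaqInBox R`, then ★ every plaquette with all four bonds in the cube is `b_B`-flat, ★ on a bond in the cube lying on a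
# plaquette NOT entirely in the cube the ball field IS `W`, and ★ cubes around separated centres are disjoint — exactly the three ball binders (hdeep)∕(hagree)∕(hdisj) of
# `…v3StartAssembly.dist1_plaqHol_startU_le`, spelled bond by bond — lane `pub-balaban3d` ∕ cell `ym3-torus`, seat `ym-ust-19936-w1` (g2, LEAD)

WHY (bus START v3.1 (iii), 02:53Z; PROGRESS 3, 03:24Z).  At an interior vertex of the region the START replaces stage (T) (tubes ▹ section) inside the cube `Q_v` by ★w3's
`ModelBox.startGauged R σ (pullB v tubeSec)` = the exponential Coons fill of the boundary logarithms in ★w5 g2's sphere axial gauge σ, gauged back: it EQUALS `pullB v tubeSec` on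
`BdryBond R` (`startGauged_eq_of_bdryBond`) and has box plaquettes `≤ b′ + 8ρ∕R + 640ρ²` on `PlaqInBox R` (`dist1_plaqB_startGauged_le`).  THIS FILE is the model-free graft of ANY
such model field `M` (those two facts are the hypotheses `hM`∕`hP` below), for general `Params` and level (the fill itself lives on `Fin 3 → ℤ` and is instantiated at `P := F.P K`,
`(F.P K).d = 3` by `rfl`, in the final assembly).
WHAT IS HERE: §1 `shift_injective'`, `boxSite_sub_e_eq`, `inBox_add_e_of_lt`∕`inBox_sub_e_of_lt` (one step inside the open box); §2 `BallBond`, `ballField` (defs), `ballField_apply_boxSite`, `ballField_apply_of_not`,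
★`plaqHol_ballField_boxSite` (= `plaqB M u μ ν` on `PlaqInBox`); §3 ★`dist1_plaqHol_ballField_le_of_bonds` (hdeep, from the four bonds), ★`bdryBond_of_not_all` + ★★`ballField_eq_of_not_all`
(hagree: a cube bond on a plaquette not entirely in the cube is a tangential boundary bond, where `M = pullB v W`), ★`eq_of_ballBond_of_ballBond` (hdisj from separated centres).
HONEST FRAMING.  Bookkeeping over `…ModelBox`; no estimate; (FL)∕`hLift` NOT proved; count-neutral helper toward R3 2′ (items 19936∕19935); registry untouched; nothing about d = 4, the
continuum, or a mass gap; YM₃ on T³ is rung R3, not Clay.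

References: T. Bałaban, Commun. Math. Phys. 102 (1985) 277–309 [Balaban1985Variational] ((11)–(14) pp.279–280); Commun. Math. Phys. 98 (1985) 17–51 [Balaban1985Averaging]
((8), (9) p.19).
-/

set_option autoImplicit false

noncomputable section

namespace Summit.QuantumFields.YangMills.Theorems.TubeStart

open Literature.MathematicalPhysics.QuantumFieldTheory.Balaban1983to89
open Summit.QuantumFields.YangMills.Theorems.ModelBox

/-! ## §1 Small chart facts -/

section Chart

variable {P : Params} {j : ℕ}

/-- `x ↦ x + e_μ` is injective on the torus sites. [folklore] -/
theorem shift_injective' (μ : Fin P.d) {x y : Site P j} (h : x.shift μ = y.shift μ) : x = y := by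
  funext i
  have hi := congrFun h i
  simp only [Site.shift, Function.update_apply] at hi
  by_cases hμ : i = μ
  · subst hμ
    simp only [if_true] at hi
    exact add_right_cancel hi
  · simpa [hμ] using hi

/-- The chart point one step BEFORE `u` in direction `μ`: `boxSite v (u − e μ)` is the site whose shift is `boxSite v u`. [folklore] -/
theorem boxSite_sub_e_eq {v : Site P j} {u : Fin P.d → ℤ} {μ : Fin P.d} {s : Site P j} (h : boxSite v u = s.shift μ) : boxSite v (u - e μ) = s := by
  apply shift_injective' μ
  rw [← boxSite_add_e, sub_add_cancel, h]

variable {d : ℕ}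

/-- One step in a direction `i ≠ κ` stays in the box when every coordinate other than `κ` is strictly inside. [folklore] -/
theorem inBox_add_e_of_lt {R : ℕ} {u : Fin d → ℤ} (hu : InBox R u) {κ i : Fin d} (hlt : ∀ l, l ≠ κ → |u l| < (R : ℤ)) (hi : i ≠ κ) : InBox R (u + e i) := by
  intro l
  by_cases hl : l = i
  · subst hl
    rw [add_e_apply_same]
    have := hlt l hi
    rw [abs_lt] at this
    rw [abs_le]; constructor <;> omega
  · rw [add_e_apply_ne u hl]; exact hu l

/-- The same one step backwards. [folklore] -/
theorem inBox_sub_e_of_lt {R : ℕ} {u : Fin d → ℤ} (hu : InBox R u) {κ i : Fin d} (hlt : ∀ l, l ≠ κ → |u l| < (R : ℤ)) (hi : i ≠ κ) : InBox R (u - e i) := by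
  intro l
  by_cases hl : l = i
  · subst hl
    have h1 : (u - e l) l = u l - 1 := by simp [e_apply_same]
    rw [h1]
    have := hlt l hi
    rw [abs_lt] at this
    rw [abs_le]; constructor <;> omega
  · have h1 : (u - e i) l = u l := by simp [e_apply_ne hl]
    rw [h1]; exact hu l

end Chart

/-! ## §2 The ball field -/

section Ball

variable {P : Params} {j : ℕ} {G : Type*}

/-- `b` is a **BALL BOND** of the cube of half-side `R` around `v`: both endpoints are charted in the box. [folklore] -/
def BallBond (v : Site P j) (R : ℕ) (b : PBond P j) : Prop := ∃ u, InBox R u ∧ InBox R (u + e b.dir) ∧ boxSite v u = b.src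

open Classical in
/-- **THE BALL FIELD**: the model field `M` (in chart coordinates) on the ball bonds, `W` elsewhere. [cite: Balaban1985Variational, (11) p.279] -/
def ballField (v : Site P j) (R : ℕ) (M : (Fin P.d → ℤ) → Fin P.d → G) (W : GaugeField P j G) : GaugeField P j G := fun b =>
  if h : BallBond v R b then M (Classical.choose h) b.dir else W b

variable (v : Site P j) {R : ℕ} (hN : 2 * R + 1 ≤ P.sitesPerDir j) (M : (Fin P.d → ℤ) → Fin P.d → G) (W : GaugeField P j G)
include hN

/-- On a charted ball bond the ball field is the model field (the chart is injective on the box, `2R + 1 ≤ N_j`). [folklore] -/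
theorem ballField_apply_boxSite {u : Fin P.d → ℤ} {κ : Fin P.d} (hu : InBox R u) (hu' : InBox R (u + e κ)) : ballField v R M W ⟨boxSite v u, κ⟩ = M u κ := by
  classical
  have h : BallBond v R ⟨boxSite v u, κ⟩ := ⟨u, hu, hu', rfl⟩
  unfold ballField
  rw [dif_pos h]
  obtain ⟨hc, -, hsrc⟩ := Classical.choose_spec h
  rw [boxSite_injOn v hN hc hu hsrc]

omit hN in
/-- Off the ball bonds the ball field is `W`. [folklore] -/
theorem ballField_apply_of_not {b : PBond P j} (h : ¬ BallBond v R b) : ballField v R M W b = W b := by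
  classical
  unfold ballField
  rw [dif_neg h]

omit hN in
/-- A charted box bond is a ball bond (constructor with the bond spelled `⟨s, κ⟩`). [folklore] -/
theorem ballBond_mk {u : Fin P.d → ℤ} {κ : Fin P.d} {s : Site P j} (hu : InBox R u) (hu' : InBox R (u + e κ)) (hs : boxSite v u = s) :
    BallBond v R ⟨s, κ⟩ := ⟨u, hu, hu', hs⟩

/-- **★ PLAQUETTES OF THE BALL FIELD INSIDE THE CUBE ARE THE MODEL PLAQUETTES.** [cite: Balaban1985Averaging, (9) p.19] -/
theorem plaqHol_ballField_boxSite [GaugeGroup G] {u : Fin P.d → ℤ} {μ ν : Fin P.d} (hμν : μ < ν) (hu : PlaqInBox R u μ ν) :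
    GaugeField.plaqHol (ballField v R M W) ⟨boxSite v u, μ, ν, hμν⟩ = plaqB M u μ ν := by
  obtain ⟨h00, h10, h01, h11⟩ := hu
  have h11' : InBox R (u + e ν + e μ) := by rw [add_e_comm u ν μ]; exact h11
  simp only [GaugeField.plaqHol, plaqB, ← boxSite_add_e]
  rw [ballField_apply_boxSite v hN M W h00 h10, ballField_apply_boxSite v hN M W h10 h11, ballField_apply_boxSite v hN M W h01 h11',
    ballField_apply_boxSite v hN M W h00 h01]

/-! ## §3 The three ball binders -/

/-- **★ (hdeep) A PLAQUETTE WITH ALL FOUR BONDS IN THE CUBE IS `b_B`-FLAT** when the model field's box plaquettes are. [cite: Balaban1985Variational, (11)–(14) pp.279–280] -/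
theorem dist1_plaqHol_ballField_le_of_bonds [GaugeGroup G] {bB : ℝ} (hP : ∀ u μ ν, μ < ν → PlaqInBox R u μ ν → GaugeGroup.dist1 (plaqB M u μ ν) ≤ bB) (q : Plaq P j)
    (h1 : BallBond v R ⟨q.src, q.μ⟩) (h2 : BallBond v R ⟨q.src.shift q.μ, q.ν⟩) (h4 : BallBond v R ⟨q.src, q.ν⟩) :
    GaugeGroup.dist1 (GaugeField.plaqHol (ballField v R M W) q) ≤ bB := by
  obtain ⟨u, hu, huμ, hsrc⟩ := h1
  obtain ⟨u₄, hu₄, hu₄ν, hsrc₄⟩ := h4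
  obtain ⟨u₂, hu₂, hu₂ν, hsrc₂⟩ := h2
  simp only at huμ hsrc hu₄ν hsrc₄ hu₂ν hsrc₂
  have e4 : u₄ = u := boxSite_injOn v hN hu₄ hu (hsrc₄.trans hsrc.symm)
  subst e4
  have e2 : u₂ = u₄ + e q.μ := boxSite_injOn v hN hu₂ huμ (by rw [hsrc₂, boxSite_add_e, hsrc₄])
  subst e2
  have hq : q = ⟨boxSite v u₄, q.μ, q.ν, q.hμν⟩ := by
    cases q
    simp only at hsrc₄
    subst hsrc₄
    rfl
  rw [hq, plaqHol_ballField_boxSite v hN M W q.hμν ⟨hu₄, huμ, hu₄ν, hu₂ν⟩]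
  exact hP _ _ _ q.hμν ⟨hu₄, huμ, hu₄ν, hu₂ν⟩

omit hN in
/-- **★ A CUBE BOND ON A PLAQUETTE NOT ENTIRELY IN THE CUBE IS A TANGENTIAL BOUNDARY BOND**: if `(u, κ)` is charted in the box, is one of the four bonds of `q`, and NOT all four bonds
of `q` are ball bonds, then some coordinate `i ≠ κ` of `u` has modulus `R`. [folklore] -/
theorem bdryBond_of_not_all (q : Plaq P j) {u : Fin P.d → ℤ} {κ : Fin P.d} (hu : InBox R u) (hu' : InBox R (u + e κ))
    (hb : (⟨boxSite v u, κ⟩ : PBond P j) = ⟨q.src, q.μ⟩ ∨ (⟨boxSite v u, κ⟩ : PBond P j) = ⟨q.src.shift q.μ, q.ν⟩ ∨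
      (⟨boxSite v u, κ⟩ : PBond P j) = ⟨q.src.shift q.ν, q.μ⟩ ∨ (⟨boxSite v u, κ⟩ : PBond P j) = ⟨q.src, q.ν⟩)
    (hnot : ¬ (BallBond v R ⟨q.src, q.μ⟩ ∧ BallBond v R ⟨q.src.shift q.μ, q.ν⟩ ∧ BallBond v R ⟨q.src.shift q.ν, q.μ⟩ ∧ BallBond v R ⟨q.src, q.ν⟩)) :
    BdryBond R u κ := by
  refine ⟨⟨hu, hu'⟩, ?_⟩
  by_contra hne
  have hlt : ∀ l, l ≠ κ → |u l| < (R : ℤ) := by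
    intro l hl
    have hle := hu l
    rcases hle.lt_or_eq with h | h
    · exact h
    · exact absurd ⟨l, hl, h⟩ hne
  have hlt' : ∀ l, l ≠ κ → |(u + e κ) l| < (R : ℤ) := fun l hl => by rw [add_e_apply_ne u hl]; exact hlt l hl
  have hμν : q.μ ≠ q.ν := ne_of_lt q.hμν
  apply hnot
  rcases hb with h | h | h | h
  · -- `b = (q.src, μ)`: `u` charts `q.src`, `κ = μ`
    have hκ : κ = q.μ := congrArg PBond.dir h
    have hs : boxSite v u = q.src := congrArg PBond.src h
    subst hκ
    have hν : InBox R (u + e q.ν) := inBox_add_e_of_lt hu hlt hμν.symm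
    have hμν' : InBox R (u + e q.μ + e q.ν) := inBox_add_e_of_lt hu' hlt' hμν.symm
    have hνμ : InBox R (u + e q.ν + e q.μ) := by rw [add_e_comm u q.ν q.μ]; exact hμν'
    exact ⟨ballBond_mk v hu hu' hs, ballBond_mk v hu' hμν' (by rw [boxSite_add_e, hs]), ballBond_mk v hν hνμ (by rw [boxSite_add_e, hs]), ballBond_mk v hu hν hs⟩
  · -- `b = (q.src + e_μ, ν)`: `u` charts `q.src + e_μ`, `κ = ν`
    have hκ : κ = q.ν := congrArg PBond.dir h
    have hs : boxSite v u = q.src.shift q.μ := congrArg PBond.src h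
    subst hκ
    have hs₀ : boxSite v (u - e q.μ) = q.src := boxSite_sub_e_eq hs
    have h₀ : InBox R (u - e q.μ) := inBox_sub_e_of_lt hu hlt hμν
    have h₀μ : InBox R (u - e q.μ + e q.μ) := by rw [sub_add_cancel]; exact hu
    have h₀ν : InBox R (u - e q.μ + e q.ν) := by
      rw [show u - e q.μ + e q.ν = u + e q.ν - e q.μ by abel]; exact inBox_sub_e_of_lt hu' hlt' hμν
    have h₀νμ : InBox R (u - e q.μ + e q.ν + e q.μ) := by rw [show u - e q.μ + e q.ν + e q.μ = u + e q.ν by abel]; exact hu'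
    exact ⟨ballBond_mk v h₀ h₀μ hs₀, ballBond_mk v hu hu' hs, ballBond_mk v h₀ν h₀νμ (by rw [boxSite_add_e, hs₀]), ballBond_mk v h₀ h₀ν hs₀⟩
  · -- `b = (q.src + e_ν, μ)`: `u` charts `q.src + e_ν`, `κ = μ`
    have hκ : κ = q.μ := congrArg PBond.dir h
    have hs : boxSite v u = q.src.shift q.ν := congrArg PBond.src h
    subst hκ
    have hs₀ : boxSite v (u - e q.ν) = q.src := boxSite_sub_e_eq hs
    have h₀ : InBox R (u - e q.ν) := inBox_sub_e_of_lt hu hlt hμν.symm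
    have h₀ν : InBox R (u - e q.ν + e q.ν) := by rw [sub_add_cancel]; exact hu
    have h₀μ : InBox R (u - e q.ν + e q.μ) := by
      rw [show u - e q.ν + e q.μ = u + e q.μ - e q.ν by abel]; exact inBox_sub_e_of_lt hu' hlt' hμν.symm
    have h₀μν : InBox R (u - e q.ν + e q.μ + e q.ν) := by rw [show u - e q.ν + e q.μ + e q.ν = u + e q.μ by abel]; exact hu'
    exact ⟨ballBond_mk v h₀ h₀μ hs₀, ballBond_mk v h₀μ h₀μν (by rw [boxSite_add_e, hs₀]), ballBond_mk v hu hu' hs, ballBond_mk v h₀ h₀ν hs₀⟩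
  · -- `b = (q.src, ν)`: `u` charts `q.src`, `κ = ν`
    have hκ : κ = q.ν := congrArg PBond.dir h
    have hs : boxSite v u = q.src := congrArg PBond.src h
    subst hκ
    have hμ : InBox R (u + e q.μ) := inBox_add_e_of_lt hu hlt hμν
    have hνμ : InBox R (u + e q.ν + e q.μ) := inBox_add_e_of_lt hu' hlt' hμν
    have hμν' : InBox R (u + e q.μ + e q.ν) := by rw [add_e_comm u q.μ q.ν]; exact hνμ
    exact ⟨ballBond_mk v hu hμ hs, ballBond_mk v hμ hμν' (by rw [boxSite_add_e, hs]), ballBond_mk v hu' hνμ (by rw [boxSite_add_e, hs]), ballBond_mk v hu hu' hs⟩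

/-- **★★ (hagree) ON A CUBE BOND OF A PLAQUETTE NOT ENTIRELY IN THE CUBE THE BALL FIELD IS `W`**, provided the model field agrees with `pullB v W` on the tangential boundary bonds.
[cite: Balaban1985Variational, (11)–(13) pp.279–280] -/
theorem ballField_eq_of_not_all (hM : ∀ u κ, BdryBond R u κ → M u κ = pullB v W u κ) (q : Plaq P j) {b : PBond P j} (hb : BallBond v R b)
    (hqb : b = ⟨q.src, q.μ⟩ ∨ b = ⟨q.src.shift q.μ, q.ν⟩ ∨ b = ⟨q.src.shift q.ν, q.μ⟩ ∨ b = ⟨q.src, q.ν⟩)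
    (hnot : ¬ (BallBond v R ⟨q.src, q.μ⟩ ∧ BallBond v R ⟨q.src.shift q.μ, q.ν⟩ ∧ BallBond v R ⟨q.src.shift q.ν, q.μ⟩ ∧ BallBond v R ⟨q.src, q.ν⟩)) :
    ballField v R M W b = W b := by
  obtain ⟨u, hu, hu', hsrc⟩ := hb
  cases b with
  | mk src dir =>
    simp only at hu' hsrc
    subst hsrc
    rw [ballField_apply_boxSite v hN M W hu hu', hM u dir (bdryBond_of_not_all v q hu hu' hqb hnot), pullB_apply]

omit hN in
/-- **★ (hdisj) CUBES AROUND SEPARATED CENTRES SHARE NO BOND.** [folklore] -/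
theorem eq_of_ballBond_of_ballBond {IsBall : Site P j → Prop} (hsep : ∀ v v', IsBall v → IsBall v' → v ≠ v' → ∀ u u', InBox R u → InBox R u' → boxSite v u ≠ boxSite v' u')
    {v v' : Site P j} {b : PBond P j} (hv : IsBall v) (hv' : IsBall v') (hb : BallBond v R b) (hb' : BallBond v' R b) : v = v' := by
  by_contra hne
  obtain ⟨u, hu, -, hsrc⟩ := hb
  obtain ⟨u', hu', -, hsrc'⟩ := hb'
  exact hsep v v' hv hv' hne u u' hu hu' (hsrc.trans hsrc'.symm)

end Ball

end Summit.QuantumFields.YangMills.Theorems.TubeStart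

end
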